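import Summits.QuantumFields.BalabanUV.Beta.GAN24.PinnedScalarBounds

/-!
# `BalabanUV.Beta.GAN24.PinnedScalarOmega` — binder row G-an2-4 / (CONV-C), road P1-fibre, strip step L10 — the (M2)/(M3) «regularised closed form» ENGINE,
# REAL-ZONE HALF, part 2: the cone-corner denominator `Ω`, `q`- AND `N`-UNIFORMLY bounded below on ALL of the Brillouin zone; the dictionary with
# Y08s's Schur scalar; strip-transfer shapes (sequel of `GAN24/PinnedScalarBounds`)

NOT IN PRINT; OUR PROOF ATTEMPT.  HONEST FRAMING (cell contract, verbatim): «discharging `BetaPertH` makes Bałaban's UV stability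
UNCONDITIONAL — a real constructive-QFT result; it is NOT the continuum limit and NOT the Clay problem.»  HONEST DEPENDENCY (verbatim):
«continuum YM on T⁴ ⇐ BetaPertH ∧ nine spine estimates (0/9 proved); BetaPertH ⇐ (D1) ∧ (D4) ∧ CAP+tail; G-an2-4 gates asym, D1 and
NE2/3/4.»  [folklore] explicit elementary analysis; it discharges NOTHING of (CONV-C)'s K-slot `GAN24.CombesThomas.ConvCK 3 Lc` by itself.
NOT `BetaPertH`, NOT continuum, NOT Clay.  No `def … : Prop`, no cited fact, no wall binder; the `def`s below are an explicit real function
and an explicit constant.  STATUS IN THE CELL (honest): BANKED ENGINE for the alternative road (M2)/(M3); OFF the (M4) critical path of (I3′)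
(leaf-16-g6 `L10-CUT-M4.md`, gan24-p1-g2 ratification) — see part 1's header.

## The object
`OmegaR N q = Ω(q) = 1 − Σ_κ 4 sin²(q_κ/2N)·a′_κ(q)/ã_κ(q)` (`Omega` of leaf-02-g5's `CapacitanceClosedFormEnlarged` at real `q`, where
`∂♭₀_κ ∂₀_κ = |∂̂(q_κ/N)|² = 4 sin²(q_κ/2N)`; `a′ = capDiagOff`, `ã = aRegR` of part 1) — the ONLY new denominator of the pinned closed form.

## What is proved (every `D`, every `N ≥ 1`, EVERY `q ∈ [−π, π]^D`; constants explicit, `N`-FREE and `q`-FREE)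
* §5 **`OmegaR_ge`**: `OmegaLower D ≤ Ω(q)` with `OmegaLower D = (4/π²)^{D+1}/(1 + Dπ²·aliasWtConst D) > 0` (mechanism: the weights
  `4 sin²(q_κ/2N)/L₀` sum to `1` and `0 ≤ L₀·a′_κ/ã_κ = 1 − zeroDiag_κ/ã_κ ≤ 1 − OmegaLower D`); **`OmegaR_le_one`**; `OmegaR_of_lapR_eq_zero`
  (`Ω = 1` where `L₀ = 0`), `OmegaR_zero` (`Ω(0) = 1`); `OmegaR_pos`, `inv_OmegaR_le`.
* §6 the TELESCOPING identity `gNormSq N (x/N)·4 sin²(x/2N) = 4 sin²(x/2)` (`gNormSq_mul_four_sin_sq`; the real shadow of (T1₀)/(T2₀)) and the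
  CONSISTENCY DICTIONARY with Y08s's Schur scalar `h = capH`: `2 L₀²·Ω(q) = w_0·h(q)` at `q ≠ 0` (`OmegaR_dictionary` — the real form of
  leaf-02-g5's `hSum_aReg_eq`: `hSum ã δ δ' = 2L₀Ω/w₀`, `h = L₀·hSum ã δ δ'`).
* §7 STRIP-TRANSFER SHAPES (pure bookkeeping): a complex number within relative distance `θ < 1` of a positive real anchor `r` has
  `re ≥ (1−θ)r`, is `≠ 0`, and `‖z⁻¹‖ ≤ ((1−θ)r)⁻¹` (`re_ge/norm_ge/ne_zero/norm_inv_le_of_norm_sub_le`) — the form in which part 1's and §5's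
  real lower bounds pass to `Strip D κ₀` once a relative strip distortion `θ = C(D)·κ₀` of each scalar is supplied (leaf-18's `StripAliasBounds`,
  leaf-19-g4's `AliasStripSymbols`); the distortion itself is NOT proved here.

Unit `b2b-balaban-gan24-formalise-leaf-08` (G-an2-4 formalisation swarm, leaf prover 08), 2026-08-20.  Value = banked kernel estimate engine
toward the K-slot route P1 (alternative road (M2)/(M3) of L10(ii)), NOT on the (M4) critical path, NOT summit progress.
-/

noncomputable section

open Complex Finset
open scoped BigOperators Real

namespace Summit.QuantumFields.BalabanUV.Beta.GAN24.PinnedScalarOmega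

open AliasWeights AliasWeightsSum CapacitanceScalarBounds CapacitanceScalarBoundsBorder PinnedScalarBounds
open CapacitanceEndpointBlocks (aliasWtConst_nonneg)
open CapacitanceCancellationDefect (momSq_le_of_abs_le)
open Literature.MathematicalPhysics.QuantumFieldTheory.King1986 (momSq momSq_nonneg)

variable {D : ℕ}

/-! ## §5  The cone-corner denominator `Ω = 1 − Σ_κ 4 sin²(q_κ/2N)·a′_κ/ã_κ` -/

/-- The REGULARISED Schur-type scalar `Ω(q) = 1 − Σ_κ 4 sin²(q_κ/2N)·a′_κ(q)/ã_κ(q)` (`Omega` of `CapacitanceClosedFormEnlarged` at real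
`q`: there `∂♭₀_κ ∂₀_κ = |∂̂(q_κ/N)|² = 4 sin²(q_κ/2N)`).  The summand is written with `kfine N q 0 κ / 2 = q_κ/(2N)` so that
`Σ_κ 4 sin²(·) = lapR (kfine N q 0) = L₀` on the nose. -/
def OmegaR (N : ℕ) [NeZero N] (q : Fin D → ℝ) : ℝ :=
  1 - ∑ κ, 4 * Real.sin (kfine N q 0 κ / 2) ^ 2 * (capDiagOff N q κ / aRegR N q κ)

/-- The `N`-free, `q`-free LOWER constant `OmegaLower D = (4/π²)^{D+1}/(1 + D·π²·aliasWtConst D)` of `Ω` (`= zeroDiag`-lower / `ã`-upper). -/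
def OmegaLower (D : ℕ) : ℝ := (4 / π ^ 2) ^ (D + 1) / (1 + D * π ^ 2 * aliasWtConst D)

/-- [folklore] `0 < OmegaLower D`. -/
theorem OmegaLower_pos (D : ℕ) : 0 < OmegaLower D := by
  unfold OmegaLower
  have := aliasWtConst_nonneg D
  positivity

/-- [folklore] `OmegaLower D ≤ 1`. -/
theorem OmegaLower_le_one (D : ℕ) : OmegaLower D ≤ 1 := by
  unfold OmegaLower
  have ha := aliasWtConst_nonneg D
  have h1 : (4 / π ^ 2) ^ (D + 1) ≤ (1 : ℝ) := pow_le_one₀ (by positivity) four_div_pi_sq_le_one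
  have h2 : (1 : ℝ) ≤ 1 + D * π ^ 2 * aliasWtConst D := by
    have : (0 : ℝ) ≤ D * π ^ 2 * aliasWtConst D := by positivity
    linarith
  rw [div_le_one (by positivity)]
  exact h1.trans h2

/-- [folklore] THE RATIO BOUND behind `Ω`: `OmegaLower D ≤ zeroDiag_κ/ã_κ` (zero-alias lower bound over the `q`-uniform `ã` upper bound). -/
theorem OmegaLower_le_zeroDiag_div_aRegR {N : ℕ} [NeZero N] (hN : 1 ≤ N) {q : Fin D → ℝ} (hq : ∀ i, |q i| ≤ π) (κ : Fin D) :
    OmegaLower D ≤ zeroDiag N q κ / aRegR N q κ := by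
  have hN0 : (0 : ℝ) < N := by exact_mod_cast hN
  have ha := aRegR_pos hN hq κ
  have hz := zeroDiag_ge hN hq κ
  have hu := aRegR_le' hN hq κ
  have hU := aRegUpper_pos D
  rw [le_div_iff₀ ha]
  -- OmegaLower · ã ≤ OmegaLower · N^{D+2} aRegUpper = (4/π²)^{D+1} N^{D+2}/2 ≤ zeroDiag
  have hden : (1 + D * π ^ 2 * aliasWtConst D : ℝ) ≠ 0 := by
    have := aliasWtConst_nonneg D; positivity
  have e : OmegaLower D * ((N : ℝ) ^ (D + 2) * aRegUpper D) = (4 / π ^ 2) ^ (D + 1) * (N : ℝ) ^ (D + 2) / 2 := by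
    unfold OmegaLower aRegUpper
    calc (4 / π ^ 2) ^ (D + 1) / (1 + D * π ^ 2 * aliasWtConst D) * ((N : ℝ) ^ (D + 2) * ((1 + D * π ^ 2 * aliasWtConst D) / 2))
        = (4 / π ^ 2) ^ (D + 1) * (N : ℝ) ^ (D + 2) / 2
            * ((1 + D * π ^ 2 * aliasWtConst D) / (1 + D * π ^ 2 * aliasWtConst D)) := by ring
      _ = (4 / π ^ 2) ^ (D + 1) * (N : ℝ) ^ (D + 2) / 2 := by rw [div_self hden, mul_one]
  calc OmegaLower D * aRegR N q κ ≤ OmegaLower D * ((N : ℝ) ^ (D + 2) * aRegUpper D) :=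
        mul_le_mul_of_nonneg_left hu (OmegaLower_pos D).le
    _ = (4 / π ^ 2) ^ (D + 1) * (N : ℝ) ^ (D + 2) / 2 := e
    _ ≤ zeroDiag N q κ := hz

/-- [folklore] Each summand of `1 − Ω` is non-negative. -/
theorem OmegaR_term_nonneg {N : ℕ} [NeZero N] (hN : 1 ≤ N) {q : Fin D → ℝ} (hq : ∀ i, |q i| ≤ π) (κ : Fin D) :
    0 ≤ 4 * Real.sin (kfine N q 0 κ / 2) ^ 2 * (capDiagOff N q κ / aRegR N q κ) :=
  mul_nonneg (by positivity) (div_nonneg (capDiagOff_nonneg N q κ) (aRegR_pos hN hq κ).le)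

/-- **UPPER BOUND `Ω ≤ 1`** on the whole zone. [folklore] -/
theorem OmegaR_le_one {N : ℕ} [NeZero N] (hN : 1 ≤ N) {q : Fin D → ℝ} (hq : ∀ i, |q i| ≤ π) : OmegaR N q ≤ 1 := by
  unfold OmegaR
  linarith [Finset.sum_nonneg fun κ (_ : κ ∈ (Finset.univ : Finset (Fin D))) => OmegaR_term_nonneg hN hq κ]

/-- [folklore] THE MECHANISM, termwise: `L₀·(a′_κ/ã_κ) = 1 − zeroDiag_κ/ã_κ ≤ 1 − OmegaLower D`. -/
theorem lapR_mul_ratio_le {N : ℕ} [NeZero N] (hN : 1 ≤ N) {q : Fin D → ℝ} (hq : ∀ i, |q i| ≤ π) (κ : Fin D) :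
    lapR (kfine N q 0) * (capDiagOff N q κ / aRegR N q κ) ≤ 1 - OmegaLower D := by
  have ha := aRegR_pos hN hq κ
  have hr := OmegaLower_le_zeroDiag_div_aRegR hN hq κ
  have e : lapR (kfine N q 0) * (capDiagOff N q κ / aRegR N q κ) = 1 - zeroDiag N q κ / aRegR N q κ := by
    rw [eq_sub_iff_add_eq, ← mul_div_assoc, ← add_div, div_eq_one_iff_eq ha.ne']
    unfold aRegR
    ring
  rw [e]
  linarith

/-- [folklore] Where the zero-alias symbol vanishes (`L₀ = 0`, e.g. `q = 0`) every weight `4 sin²(q_κ/2N)` vanishes and `Ω = 1`. -/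
theorem OmegaR_of_lapR_eq_zero {N : ℕ} [NeZero N] {q : Fin D → ℝ} (h0 : lapR (kfine N q 0) = 0) : OmegaR N q = 1 := by
  have hterm : ∀ κ, 4 * Real.sin (kfine N q 0 κ / 2) ^ 2 = 0 := by
    intro κ
    have hle : 4 * Real.sin (kfine N q 0 κ / 2) ^ 2 ≤ lapR (kfine N q 0) :=
      Finset.single_le_sum (f := fun i => 4 * Real.sin (kfine N q 0 i / 2) ^ 2) (fun i _ => by positivity)
        (Finset.mem_univ κ)
    have hge : 0 ≤ 4 * Real.sin (kfine N q 0 κ / 2) ^ 2 := by positivity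
    linarith
  unfold OmegaR
  simp [hterm]

/-- [folklore] `Ω(0) = 1`. -/
theorem OmegaR_zero (N : ℕ) [NeZero N] : OmegaR N (0 : Fin D → ℝ) = 1 := by
  refine OmegaR_of_lapR_eq_zero ?_
  unfold lapR
  simp [kfine_zero]

/-- **LOWER BOUND FOR `Ω` ON THE WHOLE ZONE, `q`- AND `N`-UNIFORM**: `OmegaLower D ≤ Ω(q)`.  Mechanism: the weights
`4 sin²(q_κ/2N)/L₀` sum to `1` and each `L₀·a′_κ/ã_κ ≤ 1 − OmegaLower D`; at `L₀ = 0` the sum is empty-valued and `Ω = 1`. [folklore] -/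
theorem OmegaR_ge {N : ℕ} [NeZero N] (hN : 1 ≤ N) {q : Fin D → ℝ} (hq : ∀ i, |q i| ≤ π) : OmegaLower D ≤ OmegaR N q := by
  rcases (lapR_nonneg (kfine N q 0)).eq_or_lt with h0 | hpos
  · rw [OmegaR_of_lapR_eq_zero h0.symm]
    exact OmegaLower_le_one D
  · -- L₀ > 0: Σ_κ s_κ·r_κ = Σ_κ (s_κ/L₀)·(L₀ r_κ) ≤ (1 − OmegaLower)·Σ_κ s_κ/L₀ = 1 − OmegaLower
    set L := lapR (kfine N q 0) with hLdef
    have hsum : ∑ κ, 4 * Real.sin (kfine N q 0 κ / 2) ^ 2 = L := rfl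
    have hkey : ∑ κ, 4 * Real.sin (kfine N q 0 κ / 2) ^ 2 * (capDiagOff N q κ / aRegR N q κ)
        ≤ ∑ κ, 4 * Real.sin (kfine N q 0 κ / 2) ^ 2 / L * (1 - OmegaLower D) := by
      refine Finset.sum_le_sum fun κ _ => ?_
      have hs : 0 ≤ 4 * Real.sin (kfine N q 0 κ / 2) ^ 2 := by positivity
      have hr := lapR_mul_ratio_le hN hq κ
      rw [← hLdef] at hr
      calc 4 * Real.sin (kfine N q 0 κ / 2) ^ 2 * (capDiagOff N q κ / aRegR N q κ)
          = 4 * Real.sin (kfine N q 0 κ / 2) ^ 2 / L * (L * (capDiagOff N q κ / aRegR N q κ)) := by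
            field_simp
        _ ≤ 4 * Real.sin (kfine N q 0 κ / 2) ^ 2 / L * (1 - OmegaLower D) :=
            mul_le_mul_of_nonneg_left hr (div_nonneg hs hpos.le)
    have htot : ∑ κ, 4 * Real.sin (kfine N q 0 κ / 2) ^ 2 / L * (1 - OmegaLower D) = 1 - OmegaLower D := by
      rw [← Finset.sum_mul, ← Finset.sum_div, hsum, div_self hpos.ne', one_mul]
    unfold OmegaR
    linarith

/-- [folklore] `0 < Ω(q)` on the whole zone, every `N ≥ 1`. -/
theorem OmegaR_pos {N : ℕ} [NeZero N] (hN : 1 ≤ N) {q : Fin D → ℝ} (hq : ∀ i, |q i| ≤ π) : 0 < OmegaR N q :=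
  lt_of_lt_of_le (OmegaLower_pos D) (OmegaR_ge hN hq)

/-- [folklore] INVERSE FORM: `Ω(q)⁻¹ ≤ (OmegaLower D)⁻¹` on the whole zone. -/
theorem inv_OmegaR_le {N : ℕ} [NeZero N] (hN : 1 ≤ N) {q : Fin D → ℝ} (hq : ∀ i, |q i| ≤ π) :
    (OmegaR N q)⁻¹ ≤ (OmegaLower D)⁻¹ :=
  inv_anti₀ (OmegaLower_pos D) (OmegaR_ge hN hq)

/-! ## §6  The telescoping identity and the dictionary with Y08s's Schur scalar `h` -/

/-- [folklore] **REAL SHADOW OF THE TELESCOPING IDENTITIES (T1₀)/(T2₀)**: `‖G(x/N, N)‖²·4 sin²(x/2N) = 4 sin²(x/2)` for `|x| ≤ π`,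
`N ≥ 1` (`G·(e^{ix/N} − 1) = e^{ix} − 1`; the closed form `gNormSq_eq_sin_sq_div` off `x = 0`). -/
theorem gNormSq_mul_four_sin_sq {N : ℕ} (hN : 1 ≤ N) {x : ℝ} (hx : |x| ≤ π) :
    gNormSq N (x / N) * (4 * Real.sin (x / N / 2) ^ 2) = 4 * Real.sin (x / 2) ^ 2 := by
  have hN0 : (0 : ℝ) < N := by exact_mod_cast hN
  by_cases hs : Real.sin (x / N / 2) = 0
  · -- then x = 0
    have hy : |x / N / 2| < π := by
      rw [abs_div, abs_div, abs_of_pos hN0, abs_two, div_lt_iff₀ (by norm_num : (0:ℝ) < 2), div_lt_iff₀ hN0]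
      have h1 : (1 : ℝ) ≤ N := by exact_mod_cast hN
      nlinarith [abs_nonneg x, Real.pi_pos]
    have hx0 : x / N / 2 = 0 := by
      rw [Real.sin_eq_zero_iff_of_lt_of_lt (by linarith [(abs_lt.1 hy).1]) (abs_lt.1 hy).2] at hs
      exact hs
    have hx00 : x = 0 := by
      field_simp at hx0
      linarith [hx0]
    subst hx00
    simp
  · rw [gNormSq_eq_sin_sq_div N hs, show (N : ℝ) * (x / N) / 2 = x / 2 by field_simp]
    set s := Real.sin (x / N / 2) with hsdef
    have h2 : s ^ 2 ≠ 0 := pow_ne_zero 2 hs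
    rw [div_mul_eq_mul_div, div_eq_iff h2]
    ring

/-- [folklore] **CONSISTENCY DICTIONARY WITH Y08s's SCHUR SCALAR** at `q ≠ 0`: `2·L₀²·Ω(q) = w_0·h(q)` (`h = capH`; the real form of
leaf-02-g5's `hSum_aReg_eq`: `hSum ã δ δ' = 2L₀Ω/w₀` and `h = L₀·hSum ã δ δ'`). -/
theorem OmegaR_dictionary {N : ℕ} [NeZero N] (hN : 1 ≤ N) {q : Fin D → ℝ} (hq : ∀ i, |q i| ≤ π) (hq0 : q ≠ 0) :
    2 * lapR (kfine N q 0) ^ 2 * OmegaR N q = blockWt N q 0 * capH N q := by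
  have hN0 : (0 : ℝ) < N := by exact_mod_cast hN
  set L := lapR (kfine N q 0) with hLdef
  have hL : L ≠ 0 := (lapR_zero_pos hN hq hq0).ne'
  have hsum : ∑ κ, 4 * Real.sin (kfine N q 0 κ / 2) ^ 2 = L := rfl
  -- Ω = Σ_κ s_κ (1/L − a′_κ/ã_κ) = Σ_κ s_κ · zeroDiag_κ/(L ã_κ)
  have hΩ : OmegaR N q = ∑ κ, 4 * Real.sin (kfine N q 0 κ / 2) ^ 2 * (zeroDiag N q κ / (L * aRegR N q κ)) := by
    have hterm : ∀ κ, 4 * Real.sin (kfine N q 0 κ / 2) ^ 2 * (zeroDiag N q κ / (L * aRegR N q κ))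
        = 4 * Real.sin (kfine N q 0 κ / 2) ^ 2 / L
          - 4 * Real.sin (kfine N q 0 κ / 2) ^ 2 * (capDiagOff N q κ / aRegR N q κ) := by
      intro κ
      have ha := (aRegR_pos hN hq κ).ne'
      have ez : zeroDiag N q κ = aRegR N q κ - L * capDiagOff N q κ := by unfold aRegR; ring
      rw [ez]
      field_simp
    unfold OmegaR
    rw [Finset.sum_congr rfl fun κ _ => hterm κ, Finset.sum_sub_distrib, ← Finset.sum_div, hsum, div_self hL]
  -- each summand: s_κ · zeroDiag_κ/(L ã_κ) with ã_κ = L a_κ and s_κ·gNormSq = 4 sin²(q_κ/2)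
  have hterm2 : ∀ κ, 4 * Real.sin (kfine N q 0 κ / 2) ^ 2 * (zeroDiag N q κ / (L * aRegR N q κ))
      = blockWt N q 0 / (2 * L ^ 2) * (4 * Real.sin (q κ / 2) ^ 2 / capDiag N q κ) := by
    intro κ
    have ha := (capDiag_pos hN hq hq0 κ).ne'
    rw [aRegR_eq_lapR_mul_capDiag hN hq hq0 κ, ← hLdef, ← gNormSq_mul_four_sin_sq hN (hq κ), ← kfine_zero N q κ]
    unfold zeroDiag
    field_simp
  rw [hΩ, Finset.sum_congr rfl fun κ _ => hterm2 κ, ← Finset.mul_sum]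
  unfold capH
  field_simp

/-! ## §7  Strip-transfer shapes: a complex perturbation of a positive real anchor stays invertible -/

/-- [folklore] If `‖z − r‖ ≤ θ·r` for a real anchor `r` then `re z ≥ (1 − θ)·r`. -/
theorem re_ge_of_norm_sub_le {z : ℂ} {r θ : ℝ} (h : ‖z - r‖ ≤ θ * r) : (1 - θ) * r ≤ z.re := by
  have h1 := Complex.abs_re_le_norm (z - r)
  have h2 : (z - (r : ℂ)).re = z.re - r := by simp
  rw [h2] at h1
  have h3 := (abs_le.1 (h1.trans h)).1
  linarith

/-- [folklore] If `‖z − r‖ ≤ θ·r` then `‖z‖ ≥ (1 − θ)·r`. -/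
theorem norm_ge_of_norm_sub_le {z : ℂ} {r θ : ℝ} (h : ‖z - r‖ ≤ θ * r) : (1 - θ) * r ≤ ‖z‖ :=
  (re_ge_of_norm_sub_le h).trans (Complex.re_le_norm z)

/-- [folklore] If `‖z − r‖ ≤ θ·r` with `r > 0`, `θ < 1` then `z ≠ 0`. -/
theorem ne_zero_of_norm_sub_le {z : ℂ} {r θ : ℝ} (hr : 0 < r) (hθ : θ < 1) (h : ‖z - r‖ ≤ θ * r) : z ≠ 0 := by
  intro hz
  have h1 := norm_ge_of_norm_sub_le h
  rw [hz, norm_zero] at h1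
  have : 0 < (1 - θ) * r := mul_pos (by linarith) hr
  linarith

/-- [folklore] If `‖z − r‖ ≤ θ·r` with `r > 0`, `θ < 1` then `‖z⁻¹‖ ≤ ((1 − θ)·r)⁻¹` — the strip form of the `inv_…_le` bounds
above once the relative strip distortion `θ` of each scalar is supplied (typer row Y10zi (ii), leaf-18's L10(i)). -/
theorem norm_inv_le_of_norm_sub_le {z : ℂ} {r θ : ℝ} (hr : 0 < r) (hθ : θ < 1) (h : ‖z - r‖ ≤ θ * r) :
    ‖z⁻¹‖ ≤ ((1 - θ) * r)⁻¹ := by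
  rw [norm_inv]
  exact inv_anti₀ (mul_pos (by linarith) hr) (norm_ge_of_norm_sub_le h)

end Summit.QuantumFields.BalabanUV.Beta.GAN24.PinnedScalarOmega

end
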